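import Summits.CriticalPhenomena.Ising3DConformalLimit.Theorems.LogPolarProxyProxyUniversalityDefs
import HarnessLib

/-!
# Crux `ProxyUniversality` (stmt-CriticalPhenomena-11288), line `registered` — the EXACT SYMMETRIES of the
# finite log-polar proxy: reindexing invariance, radial mirror, azimuthal shift

Route `LogPolarProxy`, sub-problem `Ising3DConformalLimit`; skeleton `Cruxes/ProxyUniversality/Lines/birth.lean`
(v4). The one open stub of the line, LC_pin (`stub_latticeComparison`, a pure comparison of the proxy with the
cubic lattice in the pinned gauge), is constrained by — and every attack on it (proof or disproof) uses — the
exact symmetries of the finite proxy Gibbs average `⟨∏ᵢ σ_{vᵢ}⟩_{c_N}`. This file proves them in the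
vocabulary of `…Defs.lean` (`Idx`, `coupling`, `gibbsWeight`, `spinMonomial`, `spinAt`), at the level of
INDEX configurations `v : Fin n → Idx N` (so that they apply verbatim to the inlined sums of the route
decls `ProxyReflectionSymmetry` / `ProxyInversionTransfer`, items stmt-CriticalPhenomena-11290 / 11289):

* `sum_spinMonomial_mul_gibbsWeight_comp_perm`, `gibbsAvg_comp_perm` — **reindexing invariance**: for
  every permutation `e` of the index set preserving the pair couplings, `c_N(e a, e b) = c_N(a, b)`, the
  Gibbs average of the spin monomial at `e ∘ v` equals that at `v` (substitute `σ ↦ σ ∘ e` in numerator and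
  denominator; Friedli–Velenik 2017 §3.7.1 for the device);
* `coupling_radialMirror`, `gibbsAvg_radialMirror` — the **radial mirror** `i ↦ 2M − i` (`Fin.rev` on the
  radial index; in physical space the unit inversion `x ↦ x/‖x‖²`) preserves the couplings (they do not
  depend on `i`, and radial adjacency is mirror-symmetric), hence the Gibbs average — the content of the
  route's support decl `ProxyReflectionSymmetry`, in named form;
* `coupling_azimuthalShift`, `gibbsAvg_azimuthalShift` — the **azimuthal shift** `k ↦ k + 1 (mod 2N+2)`
  (`finRotate`; in physical space the rotation by `δ_N = π/(N+1)` about `e₃`) preserves the couplings (they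
  do not depend on `k`, and cyclic adjacency is shift-invariant), hence the Gibbs average.

Elementary finite sums (`Fintype.sum_bijective`, `Fintype.sum_equiv`); no definitions (the two permutations
are Mathlib's `Equiv.prodCongr Fin.revPerm (Equiv.refl _)` and
`Equiv.prodCongr (Equiv.refl _) (Equiv.prodCongr (Equiv.refl _) (finRotate _))`), no named facts.

References: S. Friedli, Y. Velenik, *Statistical Mechanics of Lattice Systems* (CUP 2017), §3.7.1
(symmetries of finite-volume Gibbs averages by change of variables) [FriedliVelenik2017]; R. C. Brower,
G. T. Fleming, H. Neuberger, Phys. Lett. B 721 (2013) 299–305 (inversion = parity in `log r` on the radial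
lattice) [BrowerFlemingNeuberger2013].
-/

noncomputable section

namespace Summit.CriticalPhenomena.Ising3DConformalLimit.Cruxes.ProxyUniversality.Birth

open scoped BigOperators
open Function
open Literature.Probability.LatticeModels

/-! ## §1 Reindexing invariance of the finite Gibbs average -/

section Reindex

variable (Jr Jt Jp : ℕ → ℕ → ℝ) (N : ℕ)

/-- A spin monomial at the permuted sites is the spin monomial at the original sites of the pulled-back
configuration: `∏ᵢ σ_{e(vᵢ)} = ∏ᵢ (σ ∘ e)_{vᵢ}`. [folklore] -/
theorem spinMonomial_comp_perm {n : ℕ} (e : Idx N ≃ Idx N) (v : Fin n → Idx N) (σ : Idx N → ℤˣ) :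
    spinMonomial (fun i => e (v i)) σ = spinMonomial v (σ ∘ e) := rfl

/-- **The Gibbs weight is invariant under pull-back by a coupling-preserving permutation**:
if `c_N(e a, e b) = c_N(a, b)` for all `a, b`, then `w(σ ∘ e) = w(σ)` (reindex the double sum by `e`).
[cite: FriedliVelenik2017, §3.7.1] -/
theorem gibbsWeight_comp_perm (e : Idx N ≃ Idx N)
    (he : ∀ a b, coupling Jr Jt Jp N (e a) (e b) = coupling Jr Jt Jp N a b) (σ : Idx N → ℤˣ) :
    gibbsWeight Jr Jt Jp N (σ ∘ e) = gibbsWeight Jr Jt Jp N σ := by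
  unfold gibbsWeight
  congr 1
  have hspin : ∀ a : Idx N, spinAt a (σ ∘ e) = spinAt (e a) σ := fun a => rfl
  simp_rw [hspin]
  calc ∑ a : Idx N, ∑ b : Idx N, coupling Jr Jt Jp N a b * (spinAt (e a) σ * spinAt (e b) σ)
      = ∑ a : Idx N, ∑ b : Idx N, coupling Jr Jt Jp N (e a) (e b) * (spinAt (e a) σ * spinAt (e b) σ) := by
        simp_rw [he]
    _ = ∑ a : Idx N, ∑ b : Idx N, coupling Jr Jt Jp N a b * (spinAt a σ * spinAt b σ) :=
        Fintype.sum_equiv e _ _ fun a => Fintype.sum_equiv e _ _ fun b => rfl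

/-- Pull-back of spin configurations by a permutation of the sites is a bijection. [folklore] -/
theorem bijective_comp_perm (e : Idx N ≃ Idx N) :
    Bijective fun σ : Idx N → ℤˣ => σ ∘ e := by
  refine ⟨fun σ τ h => ?_, fun τ => ⟨τ ∘ e.symm, ?_⟩⟩
  · funext a
    have := congr_fun h (e.symm a)
    simpa using this
  · funext a
    simp

/-- **Reindexing invariance of the numerator**: for a coupling-preserving permutation `e`,
`Σ_σ (∏ᵢ σ_{e(vᵢ)}) w(σ) = Σ_σ (∏ᵢ σ_{vᵢ}) w(σ)` (change of variables `σ ↦ σ ∘ e`). [cite: FriedliVelenik2017, §3.7.1] -/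
theorem sum_spinMonomial_mul_gibbsWeight_comp_perm {n : ℕ} (e : Idx N ≃ Idx N)
    (he : ∀ a b, coupling Jr Jt Jp N (e a) (e b) = coupling Jr Jt Jp N a b) (v : Fin n → Idx N) :
    ∑ σ : Idx N → ℤˣ, spinMonomial (fun i => e (v i)) σ * gibbsWeight Jr Jt Jp N σ =
      ∑ σ : Idx N → ℤˣ, spinMonomial v σ * gibbsWeight Jr Jt Jp N σ :=
  Fintype.sum_bijective (fun σ : Idx N → ℤˣ => σ ∘ e) (bijective_comp_perm N e) _ _ fun σ => by
    simp only [spinMonomial_comp_perm, gibbsWeight_comp_perm Jr Jt Jp N e he σ]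

/-- **Reindexing invariance of the finite Gibbs average** `⟨∏ᵢ σ_{vᵢ}⟩_{c_N}` (numerator over partition
function) under a coupling-preserving permutation of the index set. [cite: FriedliVelenik2017, §3.7.1] -/
theorem gibbsAvg_comp_perm {n : ℕ} (e : Idx N ≃ Idx N)
    (he : ∀ a b, coupling Jr Jt Jp N (e a) (e b) = coupling Jr Jt Jp N a b) (v : Fin n → Idx N) :
    (∑ σ : Idx N → ℤˣ, spinMonomial (fun i => e (v i)) σ * gibbsWeight Jr Jt Jp N σ) /
        ∑ σ : Idx N → ℤˣ, gibbsWeight Jr Jt Jp N σ =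
      (∑ σ : Idx N → ℤˣ, spinMonomial v σ * gibbsWeight Jr Jt Jp N σ) /
        ∑ σ : Idx N → ℤˣ, gibbsWeight Jr Jt Jp N σ := by
  rw [sum_spinMonomial_mul_gibbsWeight_comp_perm Jr Jt Jp N e he v]

end Reindex

/-! ## §2 The radial mirror `i ↦ 2M − i` (unit inversion) -/

section Mirror

variable (Jr Jt Jp : ℕ → ℕ → ℝ) (N : ℕ)

/-- The radial mirror acts as `(i, j, k) ↦ (Fin.rev i, j, k)`. [folklore] -/
theorem radialMirror_apply (a : Idx N) :
    (Equiv.prodCongr Fin.revPerm (Equiv.refl (Fin (N + 1) × Fin (2 * N + 2)))) a = (Fin.rev a.1, a.2) :=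
  rfl

/-- **The radial mirror preserves the proxy couplings**: the profiles `J_r N j`, `J_θ N (min j j')`,
`J_φ N j` do not depend on the radial index, polar/azimuthal adjacency does not involve it, and radial
adjacency `|i − i'| = 1` is mirror-symmetric. [cite: BrowerFlemingNeuberger2013, p. 4 (inversion = parity in t = log r)] -/
theorem coupling_radialMirror (a b : Idx N) :
    coupling Jr Jt Jp N ((Equiv.prodCongr Fin.revPerm (Equiv.refl _)) a)
        ((Equiv.prodCongr Fin.revPerm (Equiv.refl _)) b) =
      coupling Jr Jt Jp N a b := by
  obtain ⟨i, j, k⟩ := a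
  obtain ⟨i', j', k'⟩ := b
  rw [radialMirror_apply, radialMirror_apply]
  dsimp only
  have h1 : ((Fin.rev i).val + 1 = (Fin.rev i').val ∨ (Fin.rev i').val + 1 = (Fin.rev i).val) ↔
      (i.val + 1 = i'.val ∨ i'.val + 1 = i.val) := by
    rw [Fin.val_rev, Fin.val_rev]
    omega
  have h2 : (Fin.rev i = Fin.rev i') ↔ (i = i') := Fin.rev_inj
  unfold coupling
  simp only [h1, h2]

/-- **Radial-mirror symmetry of the finite Gibbs average** (the content of the route decl
`ProxyReflectionSymmetry`, stmt-CriticalPhenomena-11290, in named form): for all profiles, all `N`, `n` and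
index configurations `v`, `⟨∏ᵢ σ_{(2M − iᵥ, jᵥ, kᵥ)}⟩_{c_N} = ⟨∏ᵢ σ_{vᵢ}⟩_{c_N}`. [cite: BrowerFlemingNeuberger2013, p. 4] -/
theorem gibbsAvg_radialMirror : ∀ (Jr Jt Jp : ℕ → ℕ → ℝ) (N n : ℕ) (v : Fin n → Idx N),
    (∑ σ : Idx N → ℤˣ, spinMonomial (fun i => ((Fin.rev (v i).1, (v i).2) : Idx N)) σ *
          gibbsWeight Jr Jt Jp N σ) / ∑ σ : Idx N → ℤˣ, gibbsWeight Jr Jt Jp N σ =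
      (∑ σ : Idx N → ℤˣ, spinMonomial v σ * gibbsWeight Jr Jt Jp N σ) /
        ∑ σ : Idx N → ℤˣ, gibbsWeight Jr Jt Jp N σ :=
  fun Jr Jt Jp N _ v => gibbsAvg_comp_perm Jr Jt Jp N (Equiv.prodCongr Fin.revPerm (Equiv.refl _))
    (coupling_radialMirror Jr Jt Jp N) v

end Mirror

/-! ## §3 The azimuthal shift `k ↦ k + 1 (mod 2N+2)` (rotation by `δ_N` about `e₃`) -/

section Shift

variable (Jr Jt Jp : ℕ → ℕ → ℝ) (N : ℕ)

/-- The azimuthal shift acts as `(i, j, k) ↦ (i, j, k + 1)`. [folklore] -/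
theorem azimuthalShift_apply (a : Idx N) :
    (Equiv.prodCongr (Equiv.refl (Fin (2 * (N + 1) ^ 2 + 1)))
        (Equiv.prodCongr (Equiv.refl (Fin (N + 1))) (finRotate (2 * N + 2)))) a =
      (a.1, a.2.1, finRotate (2 * N + 2) a.2.2) :=
  rfl

/-- The value of the azimuthal shift: `k + 1` below the last index, `0` at the last index. [folklore] -/
theorem val_finRotate_azimuth (k : Fin (2 * N + 2)) :
    ((finRotate (2 * N + 2) k).val = k.val + 1 ∧ k.val < 2 * N + 1) ∨
      ((finRotate (2 * N + 2) k).val = 0 ∧ k.val = 2 * N + 1) := by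
  have h := coe_finRotate (n := 2 * N + 1) k
  by_cases hk : k = Fin.last (2 * N + 1)
  · right
    rw [if_pos hk] at h
    exact ⟨h, by rw [hk]; rfl⟩
  · left
    rw [if_neg hk] at h
    refine ⟨h, ?_⟩
    have := Fin.val_lt_last hk
    simpa using this

/-- **The azimuthal shift preserves the proxy couplings**: the profiles do not depend on `k`, radial/polar
adjacency does not involve it, and cyclic adjacency on `Fin (2N+2)` (including the wrap `{0, 2N+1}`) is
shift-invariant. [folklore] -/
theorem coupling_azimuthalShift (a b : Idx N) :
    coupling Jr Jt Jp N
        ((Equiv.prodCongr (Equiv.refl _) (Equiv.prodCongr (Equiv.refl _) (finRotate (2 * N + 2)))) a)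
        ((Equiv.prodCongr (Equiv.refl _) (Equiv.prodCongr (Equiv.refl _) (finRotate (2 * N + 2)))) b) =
      coupling Jr Jt Jp N a b := by
  obtain ⟨i, j, k⟩ := a
  obtain ⟨i', j', k'⟩ := b
  rw [azimuthalShift_apply, azimuthalShift_apply]
  dsimp only
  have hinj : (finRotate (2 * N + 2) k = finRotate (2 * N + 2) k') ↔ (k = k') :=
    (finRotate (2 * N + 2)).injective.eq_iff
  have hk := val_finRotate_azimuth N k
  have hk' := val_finRotate_azimuth N k'
  have hadj : ((finRotate (2 * N + 2) k).val + 1 = (finRotate (2 * N + 2) k').val ∨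
        (finRotate (2 * N + 2) k').val + 1 = (finRotate (2 * N + 2) k).val ∨
        ((finRotate (2 * N + 2) k).val = 0 ∧ (finRotate (2 * N + 2) k').val = 2 * N + 1) ∨
        ((finRotate (2 * N + 2) k').val = 0 ∧ (finRotate (2 * N + 2) k).val = 2 * N + 1)) ↔
      (k.val + 1 = k'.val ∨ k'.val + 1 = k.val ∨ (k.val = 0 ∧ k'.val = 2 * N + 1) ∨
        (k'.val = 0 ∧ k.val = 2 * N + 1)) := by
    have hkl := k.isLt
    have hkl' := k'.isLt
    rcases hk with ⟨h1, h2⟩ | ⟨h1, h2⟩ <;> rcases hk' with ⟨h3, h4⟩ | ⟨h3, h4⟩ <;> omega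
  unfold coupling
  simp only [hinj, hadj]

/-- **Azimuthal-shift symmetry of the finite Gibbs average**: for all profiles, all `N`, `n` and index
configurations `v`, `⟨∏ᵢ σ_{(iᵥ, jᵥ, kᵥ + 1)}⟩_{c_N} = ⟨∏ᵢ σ_{vᵢ}⟩_{c_N}` — the proxy is exactly invariant
under the rotation by `δ_N = π/(N+1)` about the `z`-axis. [folklore] -/
theorem gibbsAvg_azimuthalShift : ∀ (Jr Jt Jp : ℕ → ℕ → ℝ) (N n : ℕ) (v : Fin n → Idx N),
    (∑ σ : Idx N → ℤˣ, spinMonomial (fun i => (((v i).1, (v i).2.1, finRotate (2 * N + 2) (v i).2.2) : Idx N)) σ *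
          gibbsWeight Jr Jt Jp N σ) / ∑ σ : Idx N → ℤˣ, gibbsWeight Jr Jt Jp N σ =
      (∑ σ : Idx N → ℤˣ, spinMonomial v σ * gibbsWeight Jr Jt Jp N σ) /
        ∑ σ : Idx N → ℤˣ, gibbsWeight Jr Jt Jp N σ :=
  fun Jr Jt Jp N _ v => gibbsAvg_comp_perm Jr Jt Jp N
    (Equiv.prodCongr (Equiv.refl _) (Equiv.prodCongr (Equiv.refl _) (finRotate (2 * N + 2))))
    (coupling_azimuthalShift Jr Jt Jp N) v

end Shift

/-! ## §4 The unit inversion `x ↦ x/‖x‖²` on grid vertices: the radial mirror, off ties and in range -/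

section Inversion

/-- `round (−t) = −round t` unless `t` is a half-integer (the rounding ties). [folklore] -/
theorem round_neg_of_ne_half_int {t : ℝ} (ht : ∀ m : ℤ, t ≠ m + 1 / 2) : round (-t) = -round t := by
  have hnot : t - 1 / 2 ∉ Set.range (Int.cast : ℤ → ℝ) := by
    rintro ⟨m, hm⟩
    exact ht m (by linarith)
  rw [round_eq, round_eq, show -t + 1 / 2 = -(t - 1 / 2) by ring, Int.floor_neg,
    (Int.ceil_eq_floor_add_one_iff_notMem _).2 hnot, show t + 1 / 2 = (t - 1 / 2) + 1 by ring,
    Int.floor_add_one]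

variable {N : ℕ}

/-- Norm of the inverted point: `‖x/‖x‖²‖ = ‖x‖⁻¹`. [folklore] -/
theorem norm_inv_sq_smul {x : EuclideanSpace ℝ (Fin 3)} (hx : x ≠ 0) :
    ‖(‖x‖ ^ 2)⁻¹ • x‖ = ‖x‖⁻¹ := by
  have hn : 0 < ‖x‖ := norm_pos_iff.2 hx
  rw [norm_smul, norm_inv, norm_pow, Real.norm_eq_abs, abs_norm]
  field_simp

/-- The polar datum is inversion invariant: `(x/‖x‖²)₂ / ‖x/‖x‖²‖ = x₂/‖x‖`. [folklore] -/
theorem inv_sq_smul_polar {x : EuclideanSpace ℝ (Fin 3)} (hx : x ≠ 0) :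
    ((‖x‖ ^ 2)⁻¹ • x) 2 / ‖(‖x‖ ^ 2)⁻¹ • x‖ = x 2 / ‖x‖ := by
  have hn : 0 < ‖x‖ := norm_pos_iff.2 hx
  rw [norm_inv_sq_smul hx, PiLp.smul_apply, smul_eq_mul]
  field_simp

/-- The azimuthal datum is inversion invariant: `arg((x/‖x‖²)₀ + i (x/‖x‖²)₁) = arg(x₀ + i x₁)`
(a positive real rescaling does not change the argument). [folklore] -/
theorem inv_sq_smul_arg {x : EuclideanSpace ℝ (Fin 3)} (hx : x ≠ 0) :
    Complex.arg ⟨((‖x‖ ^ 2)⁻¹ • x) 0, ((‖x‖ ^ 2)⁻¹ • x) 1⟩ = Complex.arg ⟨x 0, x 1⟩ := by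
  have hn : 0 < ‖x‖ := norm_pos_iff.2 hx
  have hc : (⟨((‖x‖ ^ 2)⁻¹ • x) 0, ((‖x‖ ^ 2)⁻¹ • x) 1⟩ : ℂ) =
      (((‖x‖ ^ 2)⁻¹ : ℝ) : ℂ) * ⟨x 0, x 1⟩ := by
    apply Complex.ext
    · simp only [Complex.re_ofReal_mul, PiLp.smul_apply, smul_eq_mul]
    · simp only [Complex.im_ofReal_mul, PiLp.smul_apply, smul_eq_mul]
  rw [hc]
  exact Complex.arg_real_mul _ (by positivity)

/-- **The grid vertex of the inverted point is the radial mirror of the grid vertex** — off the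
rounding ties (`log‖x‖/δ_N` not a half-integer) and within the radial range (`|round(log‖x‖/δ_N)| ≤ M`,
automatic for fixed `x ≠ 0` and large `N`): `v_N(x/‖x‖²) = (2M − i, j, k)` where `v_N(x) = (i, j, k)`.
This is the exact lattice counterpart of "inversion = parity in `t = log r`". [cite: BrowerFlemingNeuberger2013, p. 4] -/
theorem vertex_inv_sq_smul {x : EuclideanSpace ℝ (Fin 3)} (hx : x ≠ 0)
    (htie : ∀ m : ℤ, Real.log ‖x‖ / (Real.pi / ((N : ℝ) + 1)) ≠ m + 1 / 2)
    (hrange : |round (Real.log ‖x‖ / (Real.pi / ((N : ℝ) + 1)))| ≤ ((N : ℤ) + 1) ^ 2) :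
    vertex N ((‖x‖ ^ 2)⁻¹ • x) = ((Fin.rev (vertex N x).1, (vertex N x).2) : Idx N) := by
  have hn : 0 < ‖x‖ := norm_pos_iff.2 hx
  have hlog : Real.log ‖(‖x‖ ^ 2)⁻¹ • x‖ / (Real.pi / ((N : ℝ) + 1)) =
      -(Real.log ‖x‖ / (Real.pi / ((N : ℝ) + 1))) := by
    rw [norm_inv_sq_smul hx, Real.log_inv, neg_div]
  have hround : round (Real.log ‖(‖x‖ ^ 2)⁻¹ • x‖ / (Real.pi / ((N : ℝ) + 1))) =
      -round (Real.log ‖x‖ / (Real.pi / ((N : ℝ) + 1))) := by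
    rw [hlog, round_neg_of_ne_half_int htie]
  unfold vertex
  simp only [Prod.mk.injEq]
  refine ⟨?_, ?_, ?_⟩
  · -- radial index: `toNat (−r + M) = 2M − toNat (r + M)` for `|r| ≤ M`
    apply Fin.ext
    simp only [Fin.val_rev]
    rw [hround]
    set r : ℤ := round (Real.log ‖x‖ / (Real.pi / ((N : ℝ) + 1))) with hr
    have hM : (((N + 1) ^ 2 : ℕ) : ℤ) = ((N : ℤ) + 1) ^ 2 := by push_cast; ring
    have hab := abs_le.1 hrange
    generalize hMz : ((N : ℤ) + 1) ^ 2 = Mz at hab hM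
    generalize hMn : (N + 1) ^ 2 = Mn at hM
    have h1 : ((Int.toNat (r + Mz) : ℕ) : ℤ) = r + Mz := Int.toNat_of_nonneg (by omega)
    have h2 : ((Int.toNat (-r + Mz) : ℕ) : ℤ) = -r + Mz := Int.toNat_of_nonneg (by omega)
    omega
  · -- polar index
    apply Fin.ext
    dsimp only
    rw [inv_sq_smul_polar hx]
  · -- azimuthal index
    apply Fin.ext
    dsimp only
    rw [inv_sq_smul_arg hx]

/-- **Inversion symmetry of the proxy average at the level of points** (off ties, in range): if every
`pᵢ ≠ 0` avoids the rounding ties at resolution `N` and lies in the radial range, then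
`⟨∏ᵢ σ_{v_N(pᵢ/‖pᵢ‖²)}⟩_{c_N} = ⟨∏ᵢ σ_{v_N(pᵢ)}⟩_{c_N}` — `vertex_inv_sq_smul` and the radial-mirror symmetry
`gibbsAvg_radialMirror`. (The mechanism of the route's support decl `ProxyInversionTransfer`,
stmt-CriticalPhenomena-11289.) [cite: BrowerFlemingNeuberger2013, p. 4] -/
theorem proxyAvg_inv_sq_smul : ∀ (Jr Jt Jp : ℕ → ℕ → ℝ) (N n : ℕ) (p : Fin n → EuclideanSpace ℝ (Fin 3)),
    (∀ i, p i ≠ 0) → (∀ i, ∀ m : ℤ, Real.log ‖p i‖ / (Real.pi / ((N : ℝ) + 1)) ≠ m + 1 / 2) →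
    (∀ i, |round (Real.log ‖p i‖ / (Real.pi / ((N : ℝ) + 1)))| ≤ ((N : ℤ) + 1) ^ 2) →
    proxyAvg Jr Jt Jp N n (fun i => (‖p i‖ ^ 2)⁻¹ • p i) = proxyAvg Jr Jt Jp N n p := by
  intro Jr Jt Jp N n p hp htie hrange
  rw [proxyAvg_eq, proxyAvg_eq]
  have hv : (fun i : Fin n => vertex N ((‖p i‖ ^ 2)⁻¹ • p i)) =
      fun i => ((Fin.rev (vertex N (p i)).1, (vertex N (p i)).2) : Idx N) :=
    funext fun i => vertex_inv_sq_smul (hp i) (htie i) (hrange i)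
  rw [hv]
  exact gibbsAvg_radialMirror Jr Jt Jp N n fun i => vertex N (p i)

end Inversion

end Summit.CriticalPhenomena.Ising3DConformalLimit.Cruxes.ProxyUniversality.Birth

end
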